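import Mathlib
import Summits.NavierStokesRegularity.NavierStokesRegularity.Theorems.DssFarFieldSlavingBlowupTypeIDssProfileGaussianGapIdentities
import HarnessLib

/-!
# Tools for the Gaussian-gap Liouville theorem: backward Grönwall, vanishing of a slice with zero
  Gaussian enstrophy, size of the right-hand side of the similarity vorticity equation, and the
  differentiability of the Gaussian enstrophy `Z(s) = ∫K|Ω(s)|²` (file 2 of pub-ns-dss theory T41 /
  cell E32; route `DssFarFieldSlaving`, crux `BlowupTypeIDssProfile`, stmt-NavierStokesRegularity-0155 —
  SUPPORT; cell pub-ns-dss, typer seat g4, 2026-08-23; lead A129 precision 4/5)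

HONEST FRAMING. Bookkeeping lemmas only (real analysis + dominated differentiation under the integral
sign); nothing here is about Navier–Stokes regularity, nothing is an exclusion, no new mathematics.

* `eq_zero_of_deriv_le_neg_mul` — backward Grönwall: `Z ≥ 0` bounded on `(−∞, s₀]` with `Z′ ≤ −κZ`,
  `κ > 0` ⇒ `Z ≡ 0` there (the cell's theory file BackwardGronwall.lean 62a6c73ca3e8b53c, verbatim).
* `eq_zero_of_integral_heatKernel_mul_norm_sq_eq_zero` — `∫K|Ω|² = 0` ⇒ `Ω ≡ 0` for continuous `Ω`.
* `norm_vorticityRHS_le` — `|ΔΩ − Ω − ½DΩ[y] − DΩ[U] + DU[Ω]| ≤ (4K₀ + 2K₀² + K₀/2)(1+|y|)` under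
  bounds `K₀` on `Ω, DΩ, D²Ω, U, DU`.
* `gaussianEnstrophy_hasDerivAt` — `Z′(s₀) = ∫K·2⟪Ω, ∂ₛΩ⟫` when `∂ₛΩ` is the right-hand side of the
  similarity vorticity equation and the bounds hold locally uniformly in `s`
  (`hasDerivAt_integral_of_dominated_loc_of_deriv_le`).
[this file; theory T41]
-/

noncomputable section

set_option linter.dupNamespace false

namespace Summit.NavierStokesRegularity.NavierStokesRegularity.Theorems.GaussianGap

open Set Function Filter MeasureTheory InnerProductSpace Real Metric
open scoped RealInnerProductSpace Laplacian ContDiff Topology BigOperators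
open Literature.Analysis Literature.Analysis.FluidPDE Literature.Analysis.UnboundedOperators
open Summit.NavierStokesRegularity.NavierStokesRegularity.Theorems

/-- **Backward Grönwall / backward exponential growth** (the cell's theory seat, BackwardGronwall.lean
62a6c73ca3e8b53c, verbatim). If `Z ≥ 0` is bounded by `B` on `(−∞, s₀]`, differentiable there with
`Z′ ≤ −κZ` (`κ > 0`), then `Z ≡ 0` on `(−∞, s₀]`: `e^{κs}Z(s)` is non-increasing, so
`Z(s) ≤ e^{κ(σ−s)}Z(σ) ≤ e^{κ(σ−s)}B → 0` as `σ → −∞`. [folklore] -/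
theorem eq_zero_of_deriv_le_neg_mul {Z Z' : ℝ → ℝ} {κ B s₀ : ℝ} (hκ : 0 < κ)
    (hZ : ∀ s ≤ s₀, 0 ≤ Z s) (hB : ∀ s ≤ s₀, Z s ≤ B)
    (hd : ∀ s ≤ s₀, HasDerivAt Z (Z' s) s) (hineq : ∀ s ≤ s₀, Z' s ≤ -κ * Z s) :
    ∀ s ≤ s₀, Z s = 0 := by
  -- W s := exp (κ s) * Z s is antitone on Iic s₀
  have hWd : ∀ s ≤ s₀, HasDerivAt (fun s => exp (κ * s) * Z s)
      (κ * exp (κ * s) * Z s + exp (κ * s) * Z' s) s := by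
    intro s hs
    have h0 : HasDerivAt (fun s : ℝ => κ * s) κ s := by
      simpa using (hasDerivAt_id s).const_mul κ
    have h1 : HasDerivAt (fun s : ℝ => exp (κ * s)) (exp (κ * s) * κ) s := h0.exp
    exact (h1.mul (hd s hs)).congr_deriv (by ring)
  have hWanti : AntitoneOn (fun s => exp (κ * s) * Z s) (Iic s₀) := by
    apply antitoneOn_of_deriv_nonpos (convex_Iic s₀)
    · intro s hs
      exact (hWd s hs).continuousAt.continuousWithinAt
    · intro s hs
      rw [interior_Iic] at hs
      exact (hWd s (le_of_lt hs)).differentiableAt.differentiableWithinAt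
    · intro s hs
      rw [interior_Iic] at hs
      rw [(hWd s (le_of_lt hs)).deriv]
      have h2 : exp (κ * s) * Z' s ≤ exp (κ * s) * (-κ * Z s) :=
        mul_le_mul_of_nonneg_left (hineq s (le_of_lt hs)) (exp_pos _).le
      nlinarith [h2, exp_pos (κ * s)]
  -- Suppose Z s₁ > 0 for some s₁ ≤ s₀; go back far enough to exceed B.
  intro s₁ hs₁
  by_contra hne
  have hpos : 0 < Z s₁ := lt_of_le_of_ne (hZ s₁ hs₁) (Ne.symm hne)
  -- choose T with (1 + κ T) Z s₁ > B, T ≥ 0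
  set T : ℝ := (B / Z s₁ + 1) / κ with hT
  have hT0 : 0 ≤ T := by
    have hBnn : 0 ≤ B := le_trans (hZ s₁ hs₁) (hB s₁ hs₁)
    positivity
  have hs : s₁ - T ≤ s₀ := by linarith
  have hmono := hWanti (show s₁ - T ∈ Iic s₀ from hs) (show s₁ ∈ Iic s₀ from hs₁) (by linarith)
  -- hmono : W s₁ ≤ W (s₁ - T)
  have hexp : exp (κ * s₁) = exp (κ * T) * exp (κ * (s₁ - T)) := by
    rw [← Real.exp_add]; ring_nf
  have hlow : exp (κ * T) * Z s₁ ≤ Z (s₁ - T) := by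
    have h3 : exp (κ * s₁) * Z s₁ ≤ exp (κ * (s₁ - T)) * Z (s₁ - T) := by simpa using hmono
    rw [hexp] at h3
    have h4 : exp (κ * (s₁ - T)) * (exp (κ * T) * Z s₁) ≤ exp (κ * (s₁ - T)) * Z (s₁ - T) := by
      simpa [mul_comm, mul_left_comm, mul_assoc] using h3
    exact le_of_mul_le_mul_left h4 (exp_pos _)
  have hgrow : B < exp (κ * T) * Z s₁ := by
    have h5 : 1 + κ * T ≤ exp (κ * T) := by
      have := Real.add_one_le_exp (κ * T); linarith
    have h6 : (1 + κ * T) * Z s₁ = 2 * Z s₁ + B := by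
      rw [hT]; field_simp; ring
    have h7 : (1 + κ * T) * Z s₁ ≤ exp (κ * T) * Z s₁ := mul_le_mul_of_nonneg_right h5 hpos.le
    linarith
  have := hB (s₁ - T) hs
  linarith

/-- A continuous non-negative multiple of the heat kernel with vanishing integral vanishes: if
`∫ K |Ω|² = 0` for a continuous `Ω` then `Ω ≡ 0`. [folklore] -/
theorem eq_zero_of_integral_heatKernel_mul_norm_sq_eq_zero
    {Ω : EuclideanSpace ℝ (Fin 3) → EuclideanSpace ℝ (Fin 3)} (hΩ : Continuous Ω) {C : ℝ}
    (hΩb : ∀ y, ‖Ω y‖ ≤ C) (hZ : ∫ y, heatKernel 1 y * ‖Ω y‖ ^ 2 = 0) (y : EuclideanSpace ℝ (Fin 3)) :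
    Ω y = 0 := by
  have hcont : Continuous fun y => heatKernel 1 y * ‖Ω y‖ ^ 2 :=
    (continuous_heatKernel 1).mul (hΩ.norm.pow 2)
  have hint : Integrable fun y => heatKernel 1 y * ‖Ω y‖ ^ 2 :=
    integrable_of_le_poly_heatKernel hcont (C := C ^ 2) (N := 0) fun y => by
      rw [Real.norm_eq_abs, abs_mul, abs_of_pos (heatKernel_one_pos y), abs_of_nonneg (by positivity),
        pow_zero, mul_one, mul_comm]
      exact mul_le_mul_of_nonneg_right (pow_le_pow_left₀ (norm_nonneg _) (hΩb y) 2)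
        (heatKernel_one_pos y).le
  have hae := (integral_eq_zero_iff_of_nonneg
    (fun y => mul_nonneg (heatKernel_one_pos y).le (by positivity)) hint).mp hZ
  have hfun := (hcont.ae_eq_iff_eq (μ := volume) continuous_const).mp hae
  have hy : heatKernel 1 y * ‖Ω y‖ ^ 2 = 0 := congrFun hfun y
  have h2 : ‖Ω y‖ ^ 2 = 0 := (mul_eq_zero.mp hy).resolve_left (heatKernel_one_pos y).ne'
  exact norm_eq_zero.mp ((pow_eq_zero_iff two_ne_zero).mp h2)

/-- **Pointwise size of the right-hand side of the similarity vorticity equation** under bounds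
`K₀` on `Ω, DΩ, D²Ω, U, DU`: `|ΔΩ − Ω − ½DΩ[y] − DΩ[U] + DU[Ω]| ≤ (4K₀ + 2K₀² + K₀/2)(1+|y|)`. [folklore] -/
theorem norm_vorticityRHS_le {Ω U : EuclideanSpace ℝ (Fin 3) → EuclideanSpace ℝ (Fin 3)} {K₀ : ℝ}
    (hΩ : ContDiff ℝ 2 Ω) (h0 : ∀ y, ‖Ω y‖ ≤ K₀) (h1 : ∀ y, ‖fderiv ℝ Ω y‖ ≤ K₀)
    (h2 : ∀ y, ‖iteratedFDeriv ℝ 2 Ω y‖ ≤ K₀) (h3 : ∀ y, ‖U y‖ ≤ K₀) (h4 : ∀ y, ‖fderiv ℝ U y‖ ≤ K₀)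
    (y : EuclideanSpace ℝ (Fin 3)) :
    ‖(Δ Ω) y - Ω y - (1 / 2 : ℝ) • fderiv ℝ Ω y y - fderiv ℝ Ω y (U y) + fderiv ℝ U y (Ω y)‖ ≤
      (4 * K₀ + 2 * K₀ * K₀ + K₀ / 2) * (1 + ‖y‖) := by
  have hK0 : 0 ≤ K₀ := (norm_nonneg _).trans (h0 y)
  have eΔ : ‖(Δ Ω) y‖ ≤ 3 * K₀ :=
    (norm_laplacian_le_three_mul_norm_iteratedFDeriv_two hΩ y).trans
      (mul_le_mul_of_nonneg_left (h2 y) (by norm_num))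
  have e1 : ‖fderiv ℝ Ω y y‖ ≤ K₀ * ‖y‖ :=
    (ContinuousLinearMap.le_opNorm (fderiv ℝ Ω y) y).trans (mul_le_mul_of_nonneg_right (h1 y) (norm_nonneg y))
  have e3 : ‖fderiv ℝ Ω y (U y)‖ ≤ K₀ * K₀ :=
    (ContinuousLinearMap.le_opNorm (fderiv ℝ Ω y) (U y)).trans (mul_le_mul (h1 y) (h3 y) (norm_nonneg _) hK0)
  have e4 : ‖fderiv ℝ U y (Ω y)‖ ≤ K₀ * K₀ :=
    (ContinuousLinearMap.le_opNorm (fderiv ℝ U y) (Ω y)).trans (mul_le_mul (h4 y) (h0 y) (norm_nonneg _) hK0)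
  have eb : ‖Ω y‖ ≤ K₀ := h0 y
  set a : EuclideanSpace ℝ (Fin 3) := (Δ Ω) y with ha
  set b : EuclideanSpace ℝ (Fin 3) := Ω y with hb
  set c : EuclideanSpace ℝ (Fin 3) := fderiv ℝ Ω y y with hc
  set d : EuclideanSpace ℝ (Fin 3) := fderiv ℝ Ω y (U y) with hd
  set e : EuclideanSpace ℝ (Fin 3) := fderiv ℝ U y (Ω y) with he
  have e2 : ‖(1 / 2 : ℝ) • c‖ = 1 / 2 * ‖c‖ := by
    rw [norm_smul, Real.norm_of_nonneg (by norm_num : (0:ℝ) ≤ 1 / 2)]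
  have hsum : ‖a - b - (1 / 2 : ℝ) • c - d + e‖ ≤ ‖a‖ + ‖b‖ + ‖(1 / 2 : ℝ) • c‖ + ‖d‖ + ‖e‖ := by
    have t1 : ‖a - b‖ ≤ ‖a‖ + ‖b‖ := norm_sub_le a b
    have t2 : ‖a - b - (1 / 2 : ℝ) • c‖ ≤ ‖a - b‖ + ‖(1 / 2 : ℝ) • c‖ := norm_sub_le _ _
    have t3 : ‖a - b - (1 / 2 : ℝ) • c - d‖ ≤ ‖a - b - (1 / 2 : ℝ) • c‖ + ‖d‖ := norm_sub_le _ _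
    have t4 : ‖a - b - (1 / 2 : ℝ) • c - d + e‖ ≤ ‖a - b - (1 / 2 : ℝ) • c - d‖ + ‖e‖ := norm_add_le _ _
    linarith
  rw [e2] at hsum
  have hy := norm_nonneg y
  have hc0 := norm_nonneg c
  nlinarith [hsum, eΔ, e1, e3, e4, eb, mul_nonneg hK0 hy]

/-- **Differentiability of the Gaussian enstrophy** `Z(s) = ∫K|Ω(s)|²` along a solution of the
similarity vorticity equation, by dominated differentiation under the integral: with locally uniform
bounds near `s₀` and `∂ₛΩ = R` pointwise, `Z′(s₀) = ∫K·2⟪Ω(s₀), R(s₀)⟫`. [folklore] -/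
theorem gaussianEnstrophy_hasDerivAt
    {Ω U : ℝ → EuclideanSpace ℝ (Fin 3) → EuclideanSpace ℝ (Fin 3)} {s₀ ε K₀ : ℝ}
    (hΩ2 : ∀ s, ContDiff ℝ 2 (Ω s)) (hU1 : ∀ s, ContDiff ℝ 1 (U s)) (hε : 0 < ε)
    (hK : ∀ s ∈ Ioo (s₀ - ε) (s₀ + ε), ∀ y,
      ‖Ω s y‖ ≤ K₀ ∧ ‖fderiv ℝ (Ω s) y‖ ≤ K₀ ∧ ‖iteratedFDeriv ℝ 2 (Ω s) y‖ ≤ K₀ ∧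
        ‖U s y‖ ≤ K₀ ∧ ‖fderiv ℝ (U s) y‖ ≤ K₀)
    (heq : ∀ s y, HasDerivAt (fun σ => Ω σ y)
      ((Δ (Ω s)) y - Ω s y - (1 / 2 : ℝ) • fderiv ℝ (Ω s) y y - fderiv ℝ (Ω s) y (U s y) +
        fderiv ℝ (U s) y (Ω s y)) s) :
    HasDerivAt (fun s => ∫ y, heatKernel 1 y * ‖Ω s y‖ ^ 2)
      (∫ y, heatKernel 1 y * (2 * ⟪Ω s₀ y,
        (Δ (Ω s₀)) y - Ω s₀ y - (1 / 2 : ℝ) • fderiv ℝ (Ω s₀) y y - fderiv ℝ (Ω s₀) y (U s₀ y) +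
          fderiv ℝ (U s₀) y (Ω s₀ y)⟫)) s₀ := by
  have cK : Continuous (heatKernel (E := EuclideanSpace ℝ (Fin 3)) 1) := continuous_heatKernel 1
  have cΩ : ∀ s, Continuous (Ω s) := fun s => (hΩ2 s).continuous
  have cR : ∀ s, Continuous fun y => (Δ (Ω s)) y - Ω s y - (1 / 2 : ℝ) • fderiv ℝ (Ω s) y y -
      fderiv ℝ (Ω s) y (U s y) + fderiv ℝ (U s) y (Ω s y) := by
    intro s
    have c1 : Continuous (Δ (Ω s)) := continuous_laplacian (hΩ2 s)
    have c2 : Continuous (fderiv ℝ (Ω s)) := (hΩ2 s).continuous_fderiv (by norm_num)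
    have c3 : Continuous (fderiv ℝ (U s)) := (hU1 s).continuous_fderiv one_ne_zero
    have c4 : Continuous (U s) := (hU1 s).continuous
    have c0 : Continuous (Ω s) := cΩ s
    have c5 : Continuous fun y => fderiv ℝ (Ω s) y y := c2.clm_apply continuous_id
    have c6 : Continuous fun y => fderiv ℝ (Ω s) y (U s y) := c2.clm_apply c4
    have c7 : Continuous fun y => fderiv ℝ (U s) y (Ω s y) := c3.clm_apply c0
    have c8 : Continuous fun y => (1 / 2 : ℝ) • fderiv ℝ (Ω s) y y := c5.const_smul (1 / 2 : ℝ)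
    exact (((c1.sub c0).sub c8).sub c6).add c7
  have hK0 : 0 ≤ K₀ := by
    obtain ⟨h0, -⟩ := hK s₀ (by constructor <;> linarith) 0
    exact (norm_nonneg _).trans h0
  set M : ℝ := 4 * K₀ + 2 * K₀ * K₀ + K₀ / 2 with hM
  have hs₀ : Ioo (s₀ - ε) (s₀ + ε) ∈ 𝓝 s₀ := Ioo_mem_nhds (by linarith) (by linarith)
  have h := hasDerivAt_integral_of_dominated_loc_of_deriv_le (μ := volume)
    (F := fun σ y => heatKernel 1 y * ‖Ω σ y‖ ^ 2)
    (F' := fun σ y => heatKernel 1 y * (2 * ⟪Ω σ y,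
      (Δ (Ω σ)) y - Ω σ y - (1 / 2 : ℝ) • fderiv ℝ (Ω σ) y y - fderiv ℝ (Ω σ) y (U σ y) +
        fderiv ℝ (U σ) y (Ω σ y)⟫))
    (bound := fun y => (2 * (K₀ * M)) * (1 + ‖y‖) ^ 1 * heatKernel 1 y) hs₀ ?_ ?_ ?_ ?_ ?_ ?_
  · exact h.2
  · exact Eventually.of_forall fun σ => (cK.mul ((cΩ σ).norm.pow 2)).aestronglyMeasurable
  · have hb := fun y => (hK s₀ (by constructor <;> linarith) y).1
    exact integrable_of_le_poly_heatKernel (cK.mul ((cΩ s₀).norm.pow 2)) (C := K₀ ^ 2) (N := 0)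
      fun y => by
        rw [Real.norm_eq_abs, abs_mul, abs_of_pos (heatKernel_one_pos y),
          abs_of_nonneg (by positivity), pow_zero, mul_one, mul_comm]
        exact mul_le_mul_of_nonneg_right (pow_le_pow_left₀ (norm_nonneg _) (hb y) 2)
          (heatKernel_one_pos y).le
  · exact (cK.mul (continuous_const.mul ((cΩ s₀).inner (cR s₀)))).aestronglyMeasurable
  · refine Eventually.of_forall fun y σ hσ => ?_
    have hKσ := hK σ hσ
    have hR := norm_vorticityRHS_le (hΩ2 σ) (fun z => (hKσ z).1) (fun z => (hKσ z).2.1)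
      (fun z => (hKσ z).2.2.1) (fun z => (hKσ z).2.2.2.1) (fun z => (hKσ z).2.2.2.2) y
    rw [Real.norm_eq_abs, abs_mul, abs_of_pos (heatKernel_one_pos y), abs_mul,
      abs_of_pos (by norm_num : (0:ℝ) < 2), pow_one]
    set r : EuclideanSpace ℝ (Fin 3) := (Δ (Ω σ)) y - Ω σ y - (1 / 2 : ℝ) • fderiv ℝ (Ω σ) y y -
      fderiv ℝ (Ω σ) y (U σ y) + fderiv ℝ (U σ) y (Ω σ y) with hr
    set b : EuclideanSpace ℝ (Fin 3) := Ω σ y with hb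
    have hb' : ‖b‖ ≤ K₀ := (hKσ y).1
    have hin : |⟪b, r⟫| ≤ ‖b‖ * ‖r‖ := abs_real_inner_le_norm b r
    have hi : |⟪b, r⟫| ≤ K₀ * (M * (1 + ‖y‖)) := hin.trans (mul_le_mul hb' hR (norm_nonneg _) hK0)
    have hKy := (heatKernel_one_pos y).le
    calc heatKernel 1 y * (2 * |⟪b, r⟫|) ≤ heatKernel 1 y * (2 * (K₀ * (M * (1 + ‖y‖)))) :=
          mul_le_mul_of_nonneg_left (mul_le_mul_of_nonneg_left hi (by norm_num)) hKy
      _ = 2 * (K₀ * M) * (1 + ‖y‖) * heatKernel 1 y := by ring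
  · exact integrable_of_le_poly_heatKernel (by fun_prop) (C := 2 * (K₀ * M)) (N := 1) fun y => by
      rw [Real.norm_eq_abs, abs_of_nonneg]
      have := (heatKernel_one_pos y).le
      positivity
  · exact Eventually.of_forall fun y σ _ => ((heq σ y).norm_sq).const_mul (heatKernel 1 y)


end Summit.NavierStokesRegularity.NavierStokesRegularity.Theorems.GaussianGap

end
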